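import Literature.Geometry.Lorentzian.LandauLifshitzPseudotensor
import Literature.MeasureTheory.Hausdorff.SphereMeasure

/-!
# Window charges (stub `stub_windowCharges`): coordinate-sphere integrals in polar form

Helper file for the line `sublinear-is-free-clean-window-charges` of the crux `InertialRecession`
(item `stmt-FinalStateConjecture-10166`), stub `stub_windowCharges`.

The Landau–Lifshitz quasi-local momentum `LandauLifshitz.quasiLocalMomentum g t ξ R μ` is a surface
integral over the coordinate sphere `{|y − ξ| = R}` of `E3` against the Euclidean Hausdorff measure
`μHE[2]`. To differentiate it along MOVING spheres (`ξ = c(t)`, `R = R(t)`) we rewrite every such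
integral over the fixed unit sphere with its polar surface measure `τ = volume.toSphere`:

  `∮_{|y−ξ|=R} f dμHE[2] = κ R² ∫ f(ξ + R α) dτ(α)`,  `κ = μHE[2](S²) / τ(S²)`

(translation invariance of `μHE[2]` plus the tree's
`Literature.MeasureTheory.Hausdorff.setIntegral_sphere_euclideanHausdorff`; the value of the finite
constant `κ` — in truth `1` — is irrelevant for the window-charge estimate), whence
`P^μ(t; ξ, R) = κ R² ∫ Σ_j h^{μ0j}(t, ξ + R α) α_j dτ(α)` (`quasiLocalMomentum_eq_toSphere`).
-/

noncomputable section

open Set Filter Metric MeasureTheory MeasureTheory.Measure Module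
open scoped Topology ENNReal

namespace Summit.FinalStateConjecture.FinalStateConjecture.Theorems.SublinearIsFree.WindowCharges

open Literature.Geometry.Lorentzian Literature.Geometry.Lorentzian.LandauLifshitz

/-! ### Translation and polar form of coordinate-sphere integrals -/

/-- **Translation of coordinate-sphere integrals**: `∮_{|y−ξ|=r} f(y) dμHE[2](y) =
∮_{|z|=r} f(z + ξ) dμHE[2](z)` (the translation `z ↦ z + ξ` is an isometry of `E3`, and `μHE[2]`
is isometry invariant). [folklore] -/
theorem setIntegral_sphere_translate (f : E3 → ℝ) (ξ : E3) (r : ℝ) :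
    ∫ y in sphere ξ r, f y ∂(μHE[2] : Measure E3) =
      ∫ z in sphere (0 : E3) r, f (z + ξ) ∂(μHE[2] : Measure E3) := by
  set e := IsometryEquiv.vaddConst ξ with he
  have hmp : MeasurePreserving e (μHE[2] : Measure E3) (μHE[2] : Measure E3) :=
    e.measurePreserving_euclideanHausdorffMeasure 2
  have hme : MeasurableEmbedding e := e.toHomeomorph.measurableEmbedding
  have hpre : e ⁻¹' sphere ξ r = sphere (0 : E3) r := by
    ext z
    simp [he]
  have h := hmp.setIntegral_preimage_emb hme f (sphere ξ r)
  rw [hpre] at h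
  rw [← h]
  rfl

/-- **Polar form of coordinate-sphere integrals**: for `r > 0`,
`∮_{|y−ξ|=r} f dμHE[2] = (κ r²) ∫ f(ξ + r α) dτ(α)` with `τ = volume.toSphere` on the unit sphere of
`E3` and `κ = μHE[2](S²) / τ(S²)` the finite proportionality constant of
`Literature.MeasureTheory.Hausdorff.setIntegral_sphere_euclideanHausdorff`. [folklore] -/
theorem setIntegral_sphere_eq_toSphere (f : E3 → ℝ) (ξ : E3) {r : ℝ} (hr : 0 < r) :
    ∫ y in sphere ξ r, f y ∂(μHE[2] : Measure E3) =
      (((μHE[2] : Measure E3) (sphere (0 : E3) 1) / (volume : Measure E3).toSphere univ).toReal *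
        r ^ 2) * ∫ α : sphere (0 : E3) 1, f (ξ + r • (α : E3)) ∂(volume : Measure E3).toSphere := by
  have hd : finrank ℝ E3 = 2 + 1 := by simp
  rw [setIntegral_sphere_translate,
    Literature.MeasureTheory.Hausdorff.setIntegral_sphere_euclideanHausdorff hd hr,
    Literature.Analysis.FluidPDE.sphereIntegral_def, smul_eq_mul]
  congr 1
  refine integral_congr_ae (ae_of_all _ fun α ↦ ?_)
  simp only [add_comm]

/-- The proportionality constant `κ = μHE[2](S²) / τ(S²)` is nonnegative (as a real number).
[folklore] -/
theorem toReal_ratio_nonneg :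
    0 ≤ (((μHE[2] : Measure E3) (sphere (0 : E3) 1) /
      (volume : Measure E3).toSphere univ).toReal) :=
  ENNReal.toReal_nonneg

/-! ### The quasi-local momentum over the unit sphere -/

/-- **The Landau–Lifshitz quasi-local momentum in polar form**: for `R > 0`,
`P^μ(t; ξ, R) = κ R² ∫ Σ_j h^{μ0j}(t, ξ + R α) α_j dτ(α)` (LL (96.16) with the outward normal
`n = α` of the coordinate sphere `y = ξ + R α`). [cite: LandauLifshitz1975, §96 (96.16)] -/
theorem quasiLocalMomentum_eq_toSphere' (g : E4 → E4 →L[ℝ] E4 →L[ℝ] ℝ) (t : ℝ) (ξ : E3) {R : ℝ}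
    (hR : 0 < R) (μ : Fin 4) :
    quasiLocalMomentum g t ξ R μ =
      (((μHE[2] : Measure E3) (sphere (0 : E3) 1) / (volume : Measure E3).toSphere univ).toReal *
        R ^ 2) * ∫ α : sphere (0 : E3) 1, ∑ j : Fin 3,
          hField g (E4.ofTimeSpace t (ξ + R • (α : E3))) μ 0 j.succ * (α : E3) j
            ∂(volume : Measure E3).toSphere := by
  rw [quasiLocalMomentum, setIntegral_sphere_eq_toSphere _ ξ hR]
  congr 1
  refine integral_congr_ae (ae_of_all _ fun α ↦ ?_)
  refine Finset.sum_congr rfl fun j _ ↦ ?_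
  rw [add_sub_cancel_left, PiLp.smul_apply, smul_eq_mul]
  field_simp

/-- **The Landau–Lifshitz quasi-local momentum in polar form** — the registered sub-goal form
(stub `quasiLocalMomentum_eq_toSphere` of the crux item) of `quasiLocalMomentum_eq_toSphere'`.
[cite: LandauLifshitz1975, §96 (96.16)] -/
theorem quasiLocalMomentum_eq_toSphere : open Literature.Geometry.Lorentzian Literature.Geometry.Lorentzian.LandauLifshitz MeasureTheory Metric in ∀ (g : E4 → E4 →L[ℝ] E4 →L[ℝ] ℝ) (t : ℝ) (ξ : E3) (R : ℝ), 0 < R → ∀ μ : Fin 4, quasiLocalMomentum g t ξ R μ = (((μHE[2] : Measure E3) (sphere (0 : E3) 1) / (volume : Measure E3).toSphere Set.univ).toReal * R ^ 2) * ∫ α : sphere (0 : E3) 1, ∑ j : Fin 3, hField g (E4.ofTimeSpace t (ξ + R • (α : E3))) μ 0 j.succ * (α : E3) j ∂(volume : Measure E3).toSphere :=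
  fun g t ξ _ hR μ ↦ quasiLocalMomentum_eq_toSphere' g t ξ hR μ

/-! ### Integrals over the unit sphere: elementary bounds -/

/-- Points of the unit sphere have norm one. [folklore] -/
theorem norm_coe_unitSphere (α : sphere (0 : E3) 1) : ‖(α : E3)‖ = 1 :=
  norm_eq_of_mem_sphere α

/-- Coordinates of points of the unit sphere are bounded by one. [folklore] -/
theorem abs_coe_unitSphere_apply_le (α : sphere (0 : E3) 1) (j : Fin 3) : |(α : E3) j| ≤ 1 := by
  have h := EuclideanSpace.norm_sq_eq (α : E3)
  rw [norm_coe_unitSphere, one_pow, Fin.sum_univ_three] at h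
  simp only [Real.norm_eq_abs, sq_abs] at h
  have hj : (α : E3) j ^ 2 ≤ 1 := by
    fin_cases j
    · simp only [Fin.zero_eta, Fin.isValue]
      nlinarith [sq_nonneg ((α : E3) 1), sq_nonneg ((α : E3) 2)]
    · simp only [Fin.mk_one, Fin.isValue]
      nlinarith [sq_nonneg ((α : E3) 0), sq_nonneg ((α : E3) 2)]
    · simp only [Fin.reduceFinMk, Fin.isValue]
      nlinarith [sq_nonneg ((α : E3) 0), sq_nonneg ((α : E3) 1)]
  exact (sq_le_one_iff_abs_le_one _).1 hj

/-- **Bounded integrands have bounded unit-sphere integrals**: if `|F α| ≤ M` for all `α` then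
`|∫ F dτ| ≤ M τ(S²)` (`τ = volume.toSphere` is a finite measure). [folklore] -/
theorem abs_integral_toSphere_le {F : sphere (0 : E3) 1 → ℝ} {M : ℝ} (hF : ∀ α, |F α| ≤ M) :
    |∫ α, F α ∂(volume : Measure E3).toSphere| ≤
      M * ((volume : Measure E3).toSphere univ).toReal := by
  have h := norm_integral_le_of_norm_le_const (μ := (volume : Measure E3).toSphere)
    (f := F) (C := M) (ae_of_all _ fun α ↦ by simpa [Real.norm_eq_abs] using hF α)
  simpa [Real.norm_eq_abs, measureReal_def] using h

end Summit.FinalStateConjecture.FinalStateConjecture.Theorems.SublinearIsFree.WindowCharges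

end
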